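import Summits.QuantumFields.YangMills.Theorems.UnitScaleTiltProp7QTwSCentralAdditive
import HarnessLib

/-!
# Route `UnitScaleTilt`, crux K1 child «MinimiserStabilityRegPr» (stmt-QuantumFields-19200), stub `stub_existenceMinimalOrbit` (EX), the J-term rows of the EX knit —
# **(Q-b)⁽²⁾ AT `U₀ ∈ 𝔘_k(ε₀)`: THE CENTRAL DIRECTIONS OF `C⁽²⁾(U₀) = ½·D²(log U̿^{twS})(0)` VANISH, MODULO ONE DISPLAYED TOWER ROW** (ym-inputs-p01 g2 12:05:39Z LOCATE; the row `hAvgC`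
# of the J-term rows, `avgHess U₀ := fderiv (fderiv logChartTwS) 0`): from the sibling ✓`…QTwSCentralAdditive` (`logChartTwS_add_central`, `fderiv_fderiv_eq_zero_of_add_eventually`)
# with the scalar rows, the `1∕8`-window of `U̿^{twS}(A)` (W2 ✓`norm_dbarTwS_sub_one_le`) and differentiability near `0` (✓`analyticOnNhd_logChartTwS`) SUPPLIED at a printed-regular background.

Cell `ym3-torus`, width seat `ym-ust-20520-w5` (gen 5).  `--supports stmt-QuantumFields-19200 --as helper`; THEOREMS ONLY (0 `def`, 0 `sorry`); count-neutral; nothing here claims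
the stub, the crux, d = 4 or the mass gap — YM₃ on T³ is a ladder rung (R3), not the Clay problem.

WHAT IS PROVED (`L := logChartTwS F n K h U₀`; `U₀ ∈ 𝔘_k(ε₀)`: `RegPr F n K ε₀ U₀`, `10¹²L³ε₀ ≤ 1`; `U₀♭ := bgUnits F K U₀`).
* `scalarTower_window_T3` (the `32ℓLᵏt ≤ 1` window at `z := −i·t·c`, `|t| < (32ℓLᵏ(Σ|c(b)| + 1))⁻¹`); `norm_dbarTwS_sub_one_le_eighth_of_regPr` (`‖U̿^{twS}(A)(c) − 1‖ ≤ 1∕8` for `‖A‖ < η∕(10⁹L²)`).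
* ★★`logChartTwS_add_smul_one_eventually_of_regPr (htower) (c)` — `L(A + t·(c·1)) = L(A) + L(t·(c·1))` for `(A, t)` near `0`.
* ★★★`fderiv_fderiv_logChartTwS_smul_one_eq_zero_of_regPr (htower) (c) (X) : fderiv ℂ (fun A => fderiv ℂ L A) 0 X (c·1) = 0 ∧ fderiv ℂ (fun A => fderiv ℂ L A) 0 (c·1) X = 0`
  (= p01 g2's `avgHess U₀ X (c·1) = 0 ∧ avgHess U₀ (c·1) X = 0` after `avgHess_def`); ★★★`fderiv_fderiv_logChartTwS_central_eq_zero_of_regPr (htower) : ∀ X z, … X (z·1) = 0`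
  = p01 g2's displayed binder `hAvgC` of `…SectET3DeltaOneT3JTermRows` VERBATIM (bus 12:20:22Z), modulo `htower`.
THE ONE DISPLAYED ROW `htower`: on some ball of `A`, at every level `j < K − n`, the (0.4) loop variables of the perturbed covariant tower `dbarCovIterU j U₀♭ (e^{A}U₀♭)` and its twisted stair
transporters against `Ū₀♭ʲ` are within `1∕8` of `1` (supplier: the W3 lineage ✓`norm_dbarCovIterU_rel_frameAccU_le_of_plaqSmall` + SU(2)-valuedness of `Ū₀♭ʲ` + a relative-holonomy letter — not
typed here).  HONEST SCOPE: compositions of landed theorems; nothing of [Balaban1985Averaging]∕[Balaban1985BackgroundPropagators] asserted.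

References: T. Bałaban, CMP **99** (1985) 389–434 [Balaban1985BackgroundPropagators] ((3.14)–(3.15) p.393, (3.127) p.421); CMP **98** (1985) 17–51 [Balaban1985Averaging] ((125)–(127) p.36,
Prop. 4 (134)–(135) p.38, (161)–(163) p.42); CMP **95** (1984) 17–40 [Balaban1984PropagatorsI] ((1.18) p.20); CMP **102** (1985) 277–309 [Balaban1985Variational] ((2) p.278, (44)–(47) p.285).
-/

set_option autoImplicit false

noncomputable section

open scoped Matrix.Norms.L2Operator
open Filter Topology Metric

namespace Summit.QuantumFields.YangMills.Theorems.Prop7SymAvgTwSym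

open NormedSpace
open Literature.MathematicalPhysics.QuantumFieldTheory.Balaban1983to89
open T4Continuum BlockAveraging AveragingRT ExpMeanLog MatrixLog BlockAveragingEMLLinearised LatticeFieldCalculus
open B10Eq27TorusAxialLog (holT)
open B7Prop1Explicit (expUnit val_expUnit)
open T3ContinuumYM3Torus
open T3LevelShift (bondShift)
open T3PrintedRegularOrbits (sites_eq)
open T3PrintedRegularMinimiser (RegPr)
open T3SectALandauChart (eta eta_pos bgUnits)
open Summit.QuantumFields.YangMills.Theorems.Prop8Chart (loopHolU emlIterU expCfg)
open Summit.QuantumFields.YangMills.Theorems.Prop8ChartDoubleBar (dbarIterU)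
open Summit.QuantumFields.YangMills.Theorems.Prop7CmapTwSymInputs (analyticOnNhd_logChartTwS)
open Summit.QuantumFields.YangMills.Theorems.Prop7CmapTwInputs (norm_apply_le_of_mem_ball)
open Summit.QuantumFields.YangMills.Theorems.Prop7DbarTwSymWindow (norm_dbarTwS_sub_one_le)

/-! ## §3 T³ at `U₀ ∈ 𝔘_k(ε₀)`: the rows other than `htower` supplied; the second-order consequence -/

section RegPr

variable (F : T3Family) {n K : ℕ} (h : n ≤ K)

/-- **THE SCALAR TOWER OF `e^{tc}` IN THE `1∕16` CURRENCY** (T³ reading of `abelianTower_small_sixteenth` at `z := −i·t·c`, `δ := (32ℓLᵏ(Σ|c(b)| + 1))⁻¹`).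
[cite: Balaban1985Averaging, Prop. 4 (134)-(135) p.38; Balaban1984PropagatorsI, (1.18) p.20] -/
theorem scalarTower_window_T3 (c : PBond (F.P K) 0 → ℂ) :
    ∃ δ : ℝ, 0 < δ ∧ ∀ t : ℂ, ‖t‖ < δ →
      32 * ((((F.P K).d + 2) * (F.P K).L : ℕ) : ℝ) * (((F.P K).L : ℝ) ^ (K - n) * (‖t‖ * ((∑ b, ‖c b‖) + 1))) ≤ 1 ∧
      ∀ b, ‖-Complex.I * t * c b‖ ≤ ‖t‖ * ((∑ b, ‖c b‖) + 1) := by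
  set ℓ : ℝ := ((((F.P K).d + 2) * (F.P K).L : ℕ) : ℝ) with hℓ
  set M : ℝ := ∑ b, ‖c b‖ with hM
  have hM0 : 0 ≤ M := by rw [hM]; exact Finset.sum_nonneg fun b _ => norm_nonneg _
  have hcM : ∀ b, ‖c b‖ ≤ M := fun b => by
    rw [hM]; exact Finset.single_le_sum (f := fun b => ‖c b‖) (fun b _ => norm_nonneg _) (Finset.mem_univ b)
  have hℓ0 : 0 < ℓ := by
    rw [hℓ]
    have h1 : 1 ≤ ((F.P K).d + 2) * (F.P K).L := le_trans (Nat.succ_le_of_lt (F.P K).L_pos) (Nat.le_mul_of_pos_left _ (by omega))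
    exact_mod_cast h1
  have hL1 : (1 : ℝ) ≤ (F.P K).L := by exact_mod_cast (F.P K).L_pos
  set D : ℝ := 32 * ℓ * ((((F.P K).L : ℝ)) ^ (K - n) * (M + 1)) with hD
  have hD0 : 0 < D := by positivity
  refine ⟨D⁻¹, inv_pos.2 hD0, fun t ht => ⟨?_, fun b => ?_⟩⟩
  · have h1 : ‖t‖ * D ≤ D⁻¹ * D := mul_le_mul_of_nonneg_right ht.le hD0.le
    rw [inv_mul_cancel₀ hD0.ne'] at h1
    calc 32 * ℓ * ((((F.P K).L : ℝ)) ^ (K - n) * (‖t‖ * (M + 1))) = ‖t‖ * D := by rw [hD]; ring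
      _ ≤ 1 := h1
  · rw [norm_mul, norm_mul, norm_neg, Complex.norm_I, one_mul]
    exact mul_le_mul_of_nonneg_left ((hcM b).trans (by linarith)) (norm_nonneg t)

/-- **`‖U̿^{twS}(A)(c) − 1‖ ≤ 1∕8` ON THE BALL `‖A‖ < η∕(10⁹L²)` AT `U₀ ∈ 𝔘_k(ε₀)`** (W2 ✓`norm_dbarTwS_sub_one_le`: `≤ 3(2e + 2700Lε₀)` at `e := (10⁹L²)⁻¹`, `10¹²L³ε₀ ≤ 1`).
[cite: Balaban1985Averaging, (161)-(163) p.42; Balaban1985Variational, (2) p.278] -/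
theorem norm_dbarTwS_sub_one_le_eighth_of_regPr {ε₀ : ℝ} (hε₀ : 0 < ε₀) (hWε : 10 ^ 12 * (F.L : ℝ) ^ 3 * ε₀ ≤ 1)
    (U₀ : GaugeField (F.P K) 0 (Matrix.specialUnitaryGroup (Fin 2) ℂ)) (hreg : RegPr F n K ε₀ U₀)
    {A : PBond (F.P K) 0 → Matrix (Fin 2) (Fin 2) ℂ} (hA : ‖A‖ < (10 ^ 9 * (F.L : ℝ) ^ 2)⁻¹ * eta F n K) (c : PBond (F.P n) 0) :
    ‖((dbarTwS F n K h U₀ A c : (Matrix (Fin 2) (Fin 2) ℂ)ˣ) : Matrix (Fin 2) (Fin 2) ℂ) - 1‖ ≤ 1 / 8 := by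
  have hL3 : 3 ≤ F.L := by obtain ⟨a, ha⟩ := F.hL.1; have := F.hL.2; omega
  have hL1 : (1 : ℝ) ≤ F.L := by exact_mod_cast (show 1 ≤ F.L by omega)
  set e : ℝ := (10 ^ 9 * (F.L : ℝ) ^ 2)⁻¹ with he
  have hpos : (0 : ℝ) < 10 ^ 9 * (F.L : ℝ) ^ 2 := by positivity
  have he0 : 0 < e := by rw [he]; exact inv_pos.2 hpos
  have hWe : 10 ^ 9 * (F.L : ℝ) ^ 2 * e ≤ 1 := by rw [he, mul_inv_cancel₀ hpos.ne']
  have h1 := (norm_dbarTwS_sub_one_le F h hε₀ he0.le hWe hWε U₀ hreg A (norm_apply_le_of_mem_ball F hA) c).1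
  refine h1.trans ?_
  -- `3(2e + 2700Lε₀) ≤ 1/8`: `e ≤ 10⁻⁹`, `Lε₀ ≤ L³ε₀ ≤ 10⁻¹²`
  have he9 : 10 ^ 9 * e ≤ 1 := by
    have : 10 ^ 9 * e ≤ 10 ^ 9 * (F.L : ℝ) ^ 2 * e := by nlinarith [he0.le, one_le_pow₀ (n := 2) hL1]
    exact this.trans hWe
  have hLε : 10 ^ 12 * ((F.L : ℝ) * ε₀) ≤ 1 := by
    have hL13 : (F.L : ℝ) ≤ (F.L : ℝ) ^ 3 := by
      calc (F.L : ℝ) = (F.L : ℝ) * 1 := by ring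
        _ ≤ (F.L : ℝ) * (F.L : ℝ) ^ 2 := mul_le_mul_of_nonneg_left (one_le_pow₀ hL1) (by positivity)
        _ = (F.L : ℝ) ^ 3 := by ring
    have : (F.L : ℝ) * ε₀ ≤ (F.L : ℝ) ^ 3 * ε₀ := mul_le_mul_of_nonneg_right hL13 hε₀.le
    linarith
  linarith

/-- ★★ **LOCAL ADDITIVITY OF THE TWISTED LOG-CHART IN CENTRAL DIRECTIONS AT `U₀ ∈ 𝔘_k(ε₀)`**: for `(A, t)` near `0`, `L(A + t·(c·1)) = L(A) + L(t·(c·1))` (`L := logChartTwS U₀`), MODULO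
the displayed row `htower` (loops and twisted stairs of the perturbed covariant tower within `1∕8` on some ball of `A`); everything else — the scalar rows, the `1∕8`-window of
`U̿^{twS}(A)`, `L(0) = 0` — supplied. [cite: Balaban1985BackgroundPropagators, (3.14)-(3.15) p.393; Balaban1985Averaging, (125)-(127) p.36, (161)-(163) p.42] -/
theorem logChartTwS_add_smul_one_eventually_of_regPr {ε₀ : ℝ} (hε₀ : 0 < ε₀) (hWε : 10 ^ 12 * (F.L : ℝ) ^ 3 * ε₀ ≤ 1)
    (U₀ : GaugeField (F.P K) 0 (Matrix.specialUnitaryGroup (Fin 2) ℂ)) (hreg : RegPr F n K ε₀ U₀)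
    (htower : ∃ ρ : ℝ, 0 < ρ ∧ ∀ A : PBond (F.P K) 0 → Matrix (Fin 2) (Fin 2) ℂ, ‖A‖ < ρ →
      (∀ j, j < K - n → ∀ (c : PBond (F.P K) (j + 1)) (i : Idx (F.P K)),
        ‖((loopHolU (dbarCovIterU j (bgUnits F K U₀) (fun b => expUnit (A b) * bgUnits F K U₀ b)) c i : (Matrix (Fin 2) (Fin 2) ℂ)ˣ) : Matrix (Fin 2) (Fin 2) ℂ) - 1‖ ≤ 1 / 8) ∧
      (∀ j, j < K - n → ∀ (y : Site (F.P K) (j + 1)) (i : Idx (F.P K)),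
        ‖((tstairU (emlIterU j (bgUnits F K U₀)) (dbarCovIterU j (bgUnits F K U₀) (fun b => expUnit (A b) * bgUnits F K U₀ b)) y i : (Matrix (Fin 2) (Fin 2) ℂ)ˣ) :
          Matrix (Fin 2) (Fin 2) ℂ) - 1‖ ≤ 1 / 8))
    (c : PBond (F.P K) 0 → ℂ) :
    ∀ᶠ p : (PBond (F.P K) 0 → Matrix (Fin 2) (Fin 2) ℂ) × ℂ in 𝓝 0,
      logChartTwS F n K h U₀ (p.1 + p.2 • fun b => c b • (1 : Matrix (Fin 2) (Fin 2) ℂ)) =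
        logChartTwS F n K h U₀ p.1 + logChartTwS F n K h U₀ (p.2 • fun b => c b • (1 : Matrix (Fin 2) (Fin 2) ℂ)) := by
  obtain ⟨ρ, hρ, htw⟩ := htower
  obtain ⟨δ, hδ, hwin⟩ := scalarTower_window_T3 F (n := n) (K := K) c
  set r : ℝ := (10 ^ 9 * (F.L : ℝ) ^ 2)⁻¹ * eta F n K with hr
  have hr0 : 0 < r := by
    have hL3 : 3 ≤ F.L := by obtain ⟨a, ha⟩ := F.hL.1; have := F.hL.2; omega
    have : (0 : ℝ) < 10 ^ 9 * (F.L : ℝ) ^ 2 := by positivity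
    exact mul_pos (inv_pos.2 this) (eta_pos F n K)
  set ε : ℝ := min ρ (min δ r) with hε
  have hε0 : 0 < ε := lt_min hρ (lt_min hδ hr0)
  filter_upwards [Metric.ball_mem_nhds (0 : (PBond (F.P K) 0 → Matrix (Fin 2) (Fin 2) ℂ) × ℂ) hε0] with p hp
  rw [Metric.mem_ball, dist_zero_right, Prod.norm_def, max_lt_iff] at hp
  obtain ⟨hA, ht⟩ := hp
  have hAρ : ‖p.1‖ < ρ := hA.trans_le (min_le_left _ _)
  have hAr : ‖p.1‖ < r := hA.trans_le ((min_le_right _ _).trans (min_le_right _ _))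
  have htδ : ‖p.2‖ < δ := ht.trans_le ((min_le_right _ _).trans (min_le_left _ _))
  obtain ⟨hsm, hzb⟩ := hwin p.2 htδ
  -- the central perturbation `t·(c·1) = (i z)·1`, `z := −i t c`
  set z : PBond (F.P K) 0 → ℂ := fun b => -Complex.I * p.2 * c b with hz
  have hIz : ∀ b, Complex.I * z b = p.2 * c b := fun b => by
    rw [hz]; ring_nf; rw [Complex.I_sq]; ring
  have hdir : (p.2 • fun b => c b • (1 : Matrix (Fin 2) (Fin 2) ℂ)) = fun b => (Complex.I * z b) • (1 : Matrix (Fin 2) (Fin 2) ℂ) := by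
    funext b; rw [Pi.smul_apply, smul_smul, hIz]
  have hsum : (p.1 + p.2 • fun b => c b • (1 : Matrix (Fin 2) (Fin 2) ℂ)) = fun b => p.1 b + (Complex.I * z b) • (1 : Matrix (Fin 2) (Fin 2) ℂ) := by
    rw [hdir]; funext b; rw [Pi.add_apply]
  have hsum0 : (fun b => (Complex.I * z b) • (1 : Matrix (Fin 2) (Fin 2) ℂ)) = fun b => (0 : PBond (F.P K) 0 → Matrix (Fin 2) (Fin 2) ℂ) b + (Complex.I * z b) • (1 : Matrix (Fin 2) (Fin 2) ℂ) := by
    funext b; rw [Pi.zero_apply, zero_add]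
  have ht0' : 0 ≤ ‖p.2‖ * ((∑ b, ‖c b‖) + 1) := by positivity
  obtain ⟨hWl, hT⟩ := htw p.1 hAρ
  obtain ⟨hWl0, hT0⟩ := htw 0 (by rw [norm_zero]; exact hρ)
  funext c'
  rw [hsum, Pi.add_apply, logChartTwS_add_central F h U₀ p.1 z ht0' hsm hzb hWl hT c' (norm_dbarTwS_sub_one_le_eighth_of_regPr F h hε₀ hWε U₀ hreg hAr c'), hdir, hsum0,
    logChartTwS_add_central F h U₀ 0 z ht0' hsm hzb hWl0 hT0 c'
      (norm_dbarTwS_sub_one_le_eighth_of_regPr F h hε₀ hWε U₀ hreg (A := 0) (by rw [norm_zero]; exact hr0) c'),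
    logChartTwS_zero, Pi.zero_apply, zero_add]

/-- ★★★ **(Q-b)⁽²⁾ — THE CENTRAL DIRECTIONS OF PRINT'S QUADRATIC TERM VANISH AT `U₀ ∈ 𝔘_k(ε₀)`**: `D²(log U̿^{twS})(0)[X, c·1] = 0` and `D²(log U̿^{twS})(0)[c·1, X] = 0` for every
fine field `X` and every complex `c` — i.e. p01 g2's `avgHess U₀ X (c·1) = 0 ∧ avgHess U₀ (c·1) X = 0` after `avgHess_def` — MODULO the displayed row `htower`; differentiability
near `0` is ✓`analyticOnNhd_logChartTwS` (`10¹²L³ε₀ ≤ 1`). [cite: Balaban1985BackgroundPropagators, (3.14) p.393, (3.127) p.421; Balaban1985Averaging, (125)-(127) p.36] -/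
theorem fderiv_fderiv_logChartTwS_smul_one_eq_zero_of_regPr {ε₀ : ℝ} (hε₀ : 0 < ε₀) (hWε : 10 ^ 12 * (F.L : ℝ) ^ 3 * ε₀ ≤ 1)
    (U₀ : GaugeField (F.P K) 0 (Matrix.specialUnitaryGroup (Fin 2) ℂ)) (hreg : RegPr F n K ε₀ U₀)
    (htower : ∃ ρ : ℝ, 0 < ρ ∧ ∀ A : PBond (F.P K) 0 → Matrix (Fin 2) (Fin 2) ℂ, ‖A‖ < ρ →
      (∀ j, j < K - n → ∀ (c : PBond (F.P K) (j + 1)) (i : Idx (F.P K)),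
        ‖((loopHolU (dbarCovIterU j (bgUnits F K U₀) (fun b => expUnit (A b) * bgUnits F K U₀ b)) c i : (Matrix (Fin 2) (Fin 2) ℂ)ˣ) : Matrix (Fin 2) (Fin 2) ℂ) - 1‖ ≤ 1 / 8) ∧
      (∀ j, j < K - n → ∀ (y : Site (F.P K) (j + 1)) (i : Idx (F.P K)),
        ‖((tstairU (emlIterU j (bgUnits F K U₀)) (dbarCovIterU j (bgUnits F K U₀) (fun b => expUnit (A b) * bgUnits F K U₀ b)) y i : (Matrix (Fin 2) (Fin 2) ℂ)ˣ) :
          Matrix (Fin 2) (Fin 2) ℂ) - 1‖ ≤ 1 / 8))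
    (c : PBond (F.P K) 0 → ℂ) (X : PBond (F.P K) 0 → Matrix (Fin 2) (Fin 2) ℂ) :
    fderiv ℂ (fun A => fderiv ℂ (logChartTwS F n K h U₀) A) 0 X (fun b => c b • (1 : Matrix (Fin 2) (Fin 2) ℂ)) = 0 ∧
      fderiv ℂ (fun A => fderiv ℂ (logChartTwS F n K h U₀) A) 0 (fun b => c b • (1 : Matrix (Fin 2) (Fin 2) ℂ)) X = 0 := by
  -- differentiability near `0`: analyticity on the ball of radius `e·η`, `e := (10⁹L²)⁻¹`
  have hL3 : 3 ≤ F.L := by obtain ⟨a, ha⟩ := F.hL.1; have := F.hL.2; omega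
  set e : ℝ := (10 ^ 9 * (F.L : ℝ) ^ 2)⁻¹ with he
  have hpos : (0 : ℝ) < 10 ^ 9 * (F.L : ℝ) ^ 2 := by positivity
  have he0 : 0 < e := by rw [he]; exact inv_pos.2 hpos
  have hWe : 10 ^ 9 * (F.L : ℝ) ^ 2 * e ≤ 1 := by rw [he, mul_inv_cancel₀ hpos.ne']
  have han := analyticOnNhd_logChartTwS F h hε₀ he0 hWe hWε U₀ hreg
  have hdiff : ∀ᶠ A in 𝓝 (0 : PBond (F.P K) 0 → Matrix (Fin 2) (Fin 2) ℂ), DifferentiableAt ℂ (logChartTwS F n K h U₀) A := by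
    filter_upwards [Metric.ball_mem_nhds (0 : PBond (F.P K) 0 → Matrix (Fin 2) (Fin 2) ℂ) (mul_pos he0 (eta_pos F n K))] with A hA
    exact (han A hA).differentiableAt
  exact fderiv_fderiv_eq_zero_of_add_eventually hdiff (logChartTwS_add_smul_one_eventually_of_regPr F h hε₀ hWε U₀ hreg htower c) X

/-- ★★★ **p01 g2's DISPLAYED ROW `hAvgC` OF ✓`…SectET3DeltaOneT3JTermRows`, VERBATIM, MODULO `htower`**: `∀ X z, fderiv ℂ (fun A => fderiv ℂ (logChartTwS F n K h U₀) A) 0 X (z·1) = 0`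
(= `avgHess F n K h U₀ X (fun b => z b • 1) = 0` by `avgHess_def`) at `U₀ ∈ 𝔘_k(ε₀)`, `10¹²L³ε₀ ≤ 1`. [cite: Balaban1985BackgroundPropagators, (3.14) p.393, (3.127) p.421] -/
theorem fderiv_fderiv_logChartTwS_central_eq_zero_of_regPr {ε₀ : ℝ} (hε₀ : 0 < ε₀) (hWε : 10 ^ 12 * (F.L : ℝ) ^ 3 * ε₀ ≤ 1)
    (U₀ : GaugeField (F.P K) 0 (Matrix.specialUnitaryGroup (Fin 2) ℂ)) (hreg : RegPr F n K ε₀ U₀)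
    (htower : ∃ ρ : ℝ, 0 < ρ ∧ ∀ A : PBond (F.P K) 0 → Matrix (Fin 2) (Fin 2) ℂ, ‖A‖ < ρ →
      (∀ j, j < K - n → ∀ (c : PBond (F.P K) (j + 1)) (i : Idx (F.P K)),
        ‖((loopHolU (dbarCovIterU j (bgUnits F K U₀) (fun b => expUnit (A b) * bgUnits F K U₀ b)) c i : (Matrix (Fin 2) (Fin 2) ℂ)ˣ) : Matrix (Fin 2) (Fin 2) ℂ) - 1‖ ≤ 1 / 8) ∧
      (∀ j, j < K - n → ∀ (y : Site (F.P K) (j + 1)) (i : Idx (F.P K)),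
        ‖((tstairU (emlIterU j (bgUnits F K U₀)) (dbarCovIterU j (bgUnits F K U₀) (fun b => expUnit (A b) * bgUnits F K U₀ b)) y i : (Matrix (Fin 2) (Fin 2) ℂ)ˣ) :
          Matrix (Fin 2) (Fin 2) ℂ) - 1‖ ≤ 1 / 8)) :
    ∀ (X : PBond (F.P K) 0 → Matrix (Fin 2) (Fin 2) ℂ) (z : PBond (F.P K) 0 → ℂ),
      fderiv ℂ (fun A => fderiv ℂ (logChartTwS F n K h U₀) A) 0 X (fun b => z b • (1 : Matrix (Fin 2) (Fin 2) ℂ)) = 0 :=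
  fun X z => (fderiv_fderiv_logChartTwS_smul_one_eq_zero_of_regPr F h hε₀ hWε U₀ hreg htower z X).1

end RegPr

end Summit.QuantumFields.YangMills.Theorems.Prop7SymAvgTwSym

end
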